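import Mathlib
import HarnessLib
import Summits.AtomisticToContinuum.BoseEinsteinCondensation.Theses.BECGroundStateSOS
import Literature.MathematicalPhysics.QuantumLattice.KroneckerTraceSchwarz
import Literature.MathematicalPhysics.QuantumLattice.XYOrderInfrared
import Literature.MathematicalPhysics.QuantumLattice.HeisenbergModel

/-!
# Crux-ideate sketch (ideator 3, round 1) for `LatticeODLROOffHalfFilling`

First lemmas of the crux idea cards, as `Prop`s over tree declarations (nothing is proved here).

* Card `bochner-twist-insertion-transport`:
  `DecoratedTraceSchwarz` (the decorated Dyson–Lieb–Simon / FILS trace Schwarz inequality, all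
  matrices complex, an arbitrary insertion `W̄ ⊗ W`), `TwistedGaussianDomination` (Gaussian domination
  for the XY torus Gibbs weight twisted by any nonnegative combination of the characters
  `exp(iφ S³_tot)` — the positive-definite ("Bochner") sector twists), `OneHoleLRO` (the first rung:
  long-range order of the torus ground states with ONE boson added to half filling), and the transfer
  target `PerParticleModeTransport` (one-sided per-particle increment bound of the sector structure
  factor, mode by mode), with the shape lemma `transport_shape`.
-/

namespace Summit.AtomisticToContinuum.BoseEinsteinCondensation.Cruxes.LatticeODLROOffHalfFilling.Ideator3

open Matrix Kronecker
open Literature.MathematicalPhysics.QuantumLattice Literature.Probability.LatticeModels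

/-- FIRST LEMMA (card `bochner-twist-insertion-transport`). Decorated trace Schwarz inequality in the
FILS frame `θ(1 ⊗ A) = Ā ⊗ 1`: for ARBITRARY complex square matrices `A, B, W` and a finite family
`C`, with `T X Y := Tr[(W̄ ⊗ W) · exp(X̄ ⊗ 1 + 1 ⊗ Y + Σᵢ C̄ᵢ ⊗ Cᵢ)]`, the diagonal values `T A A`
are nonnegative reals and `|T A B|² ≤ T A A · T B B`. (`W = 1`: FILS Thm 2.1 matrix form and the
DLS Lemma 4.1 Schwarz inequality; the insertion `W̄ ⊗ W` rides through the Trotter/word expansion,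
each word contributing `conj(Tr(W U_w(A))) · Tr(W U_w(B))` with a nonnegative weight.) -/
def DecoratedTraceSchwarz : Prop :=
  ∀ (m : Type) [Fintype m] [DecidableEq m] (ι : Type) [Fintype ι]
    (A B W : Matrix m m ℂ) (C : ι → Matrix m m ℂ),
    let T : Matrix m m ℂ → Matrix m m ℂ → ℂ := fun X Y =>
      ((W.map (starRingEnd ℂ) ⊗ₖ W) *
        NormedSpace.exp (X.map (starRingEnd ℂ) ⊗ₖ (1 : Matrix m m ℂ) + (1 : Matrix m m ℂ) ⊗ₖ Y +
          ∑ i, (C i).map (starRingEnd ℂ) ⊗ₖ C i)).trace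
    (0 ≤ (T A A).re ∧ (T A A).im = 0) ∧ ‖T A B‖ ^ 2 ≤ (T A A).re * (T B B).re

/-- The positive-definite ("Bochner") sector twist `G = Σ_k w_k exp(i φ_k S³_tot)`, `w_k ≥ 0`, on the
spin-½ torus `(ℤ/Lℤ)^d` (a nonnegative combination of characters of the conserved charge; as a
function of `M = S³_tot` it is `g̃(M) = Σ_k w_k e^{iφ_k M}`, positive definite on `ℤ`). -/
noncomputable def sectorTwist {d : ℕ} (L : ℕ) [NeZero L] {K : ℕ} (φ w : Fin K → ℝ) :
    Op (TorusSite d L) 2 :=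
  ∑ k, ((w k : ℝ) : ℂ) • NormedSpace.exp ((Complex.I * ((φ k : ℝ) : ℂ)) • totalSpin (Λ := TorusSite d L) 1 2)

/-- SECOND LEMMA (card `bochner-twist-insertion-transport`): TWISTED GAUSSIAN DOMINATION. For the
spin-½ XY torus (even side `L ≥ 4`, any `d`, any `β > 0`), every nonnegative character combination
`G = sectorTwist L φ w` and every real field `h`:
`|Tr[G e^{-βH(h)}]| ≤ Re Tr[G e^{-βH(0)}]` with `H(h) = xyFieldHamiltonian L 1 h`.
(From `DecoratedTraceSchwarz` with `W = exp(-iφ_k Q)` per character — in the Kronecker frame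
`exp(iφ S³_tot) = exp(iφQ) ⊗ conj(exp(iφQ))` — Cauchy–Schwarz over `k`, reality of the twisted traces
(complex conjugation ∘ particle–hole), and the KLS bad-bond descent.) -/
def TwistedGaussianDomination : Prop :=
  ∀ (d L : ℕ) [NeZero L], Even L → 4 ≤ L → ∀ β : ℝ, 0 < β →
    ∀ (K : ℕ) (φ w : Fin K → ℝ), (∀ k, 0 ≤ w k) → ∀ h : TorusSite d L → ℝ,
      ‖(sectorTwist L φ w * Matrix.gibbsWeight β (xyFieldHamiltonian L 1 h)).trace‖ ≤
        ((sectorTwist L φ w * Matrix.gibbsWeight β (xyTorus d L 1)).trace).re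

/-- The transverse structure factor of a state vector `ψ` at dual-torus momentum `q`:
`ĝ_ψ(q) = L^{-d} Re⟨ψ, (C_q² + D_q²) ψ⟩` (`C_q, D_q` the cosine/sine modes of `S¹`; for the tracial
ground state this is `xyStructureFactor 0`, cf. `hcStructureFactor_eq_modes`). -/
noncomputable def vecStructureFactor {d : ℕ} (L : ℕ) [NeZero L]
    (ψ : TensorIndex (TorusSite d L) 2 → ℂ) (q : TorusSite d L) : ℝ :=
  (star ψ ⬝ᵥ ((xyCosMode L 1 q * xyCosMode L 1 q + xySinMode L 1 q * xySinMode L 1 q) *ᵥ ψ)).re /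
    (L : ℝ) ^ d

/-- `ψ` is a normalised lowest-energy vector of the spin-½ XY torus `(ℤ/Lℤ)³` in the magnetisation
sector `S³_tot = M` (hard-core bosons with `N = L³/2 + M` particles). -/
def IsSectorGround (L : ℕ) [NeZero L] (M : ℝ) (ψ : TensorIndex (TorusSite 3 L) 2 → ℂ) : Prop :=
  ψ ∈ spinZSector (Λ := TorusSite 3 L) 1 M ∧ star ψ ⬝ᵥ ψ = 1 ∧
    (xyTorus 3 L 1) *ᵥ ψ = ((lowestEnergyInSector 1 (xyTorus 3 L 1) M : ℝ) : ℂ) • ψ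

/-- FIRST RUNG (card `bochner-twist-insertion-transport`, the theorem the twisted ensembles deliver):
ONE-HOLE LONG-RANGE ORDER. The ground states of the spin-½ XY ferromagnet on `(ℤ/2kℤ)³` with ONE
boson added to half filling (`S³_tot = 1`) have off-diagonal long-range order, uniformly in `k`:
planar moment `⟨(S¹_tot)² + (S²_tot)²⟩ ≥ c |Λ|²`. (Fejér-2 twist `g̃ = δ₀ + ½δ_{±1}` at
`L² log L ≪ β ≪ L³`: twisted GD ⇒ twisted IR bound ⇒ `ĝ_{±1}(q) ≤ √2 ×` KLS bound ⇒ KLS sum rule with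
`√2 · I(3) ≈ 0.50 < 1/√2`.) -/
def OneHoleLRO : Prop :=
  ∃ c : ℝ, 0 < c ∧ ∃ L₀ : ℕ, ∀ (L : ℕ) [NeZero L], Even L → L₀ ≤ L →
    ∀ ψ : TensorIndex (TorusSite 3 L) 2 → ℂ, IsSectorGround L 1 ψ →
      c * ((L : ℝ) ^ 3) ^ 2 ≤
        (star ψ ⬝ᵥ ((totalSpin (Λ := TorusSite 3 L) 1 0 * totalSpin 1 0 +
          totalSpin (Λ := TorusSite 3 L) 1 1 * totalSpin 1 1) *ᵥ ψ)).re

/-- TRANSFER TARGET `C⁺` (card `bochner-twist-insertion-transport`): PER-PARTICLE MODE TRANSPORT.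
There are `m₀ > 0` and `C` such that on every even torus `(ℤ/2kℤ)³`, for every magnetisation `M`
with `|M| ≤ m₀|Λ|` and every momentum `q ≠ 0`, adding ONE boson raises the transverse structure
factor at `q` by at most `C / (|Λ| √E_q)` (`E_q = Σᵢ(1 - cos qᵢ)`):
`ĝ_{M+1}(q) ≤ ĝ_M(q) + C/(|Λ|√E_q)` for sector ground vectors. (Summing `M = 0 … m|Λ|` turns the
KLS infrared bound at half filling into `ĝ_{m|Λ|}(q) ≤ KLS(q) + C m/√E_q`, and
`|Λ|⁻¹Σ_{q≠0} 1/√E_q → ∫ dq/((2π)³√E_q) < ∞` keeps the KLS sum-rule budget for `m` small; by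
particle–hole symmetry the same for `M < 0`.) -/
def PerParticleModeTransport : Prop :=
  ∃ m₀ : ℝ, 0 < m₀ ∧ ∃ C : ℝ, ∀ (L : ℕ) [NeZero L], Even L → 4 ≤ L →
    ∀ M : ℤ, |(M : ℝ)| ≤ m₀ * (L : ℝ) ^ 3 →
      ∀ ψ ψ' : TensorIndex (TorusSite 3 L) 2 → ℂ,
        IsSectorGround L M ψ → IsSectorGround L (M + 1) ψ' →
          ∀ q : TorusSite 3 L, q ≠ 0 →
            vecStructureFactor L ψ' q ≤ vecStructureFactor L ψ q +
              C / ((L : ℝ) ^ 3 * Real.sqrt (dispersion (latticeMomentum L q)))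

/-- Shape of the line (pure logic placeholder, NOT the composition — that is crux-plan's job):
the transfer target together with the in-tree KLS anchor is what the card proposes to feed into the
route decl. Stated as a `Prop` so that the sketch records the intended implication. -/
def LineShape : Prop :=
  TwistedGaussianDomination → PerParticleModeTransport →
    Summit.AtomisticToContinuum.BoseEinsteinCondensation.Theses.BECGroundStateSOS.LatticeODLROOffHalfFilling

end Summit.AtomisticToContinuum.BoseEinsteinCondensation.Cruxes.LatticeODLROOffHalfFilling.Ideator3
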